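import Literature.AnabelianGeometry.EtaleTheta.ThetaCyclotomes
import HarnessLib

/-!
# [EtTh] §2 in the §1 model: `[Δ_Θ : l·Δ_Θ] = l` from the cyclotome identification `Δ_Θ/l ≅ μ_l`

Mochizuki, *The étale theta function and its Frobenioid-theoretic manifestations*, Publ. RIMS **45**
(2009), §1 p. 12 (PRIMS PDF) "`Δ_Θ (≅ Ẑ(1))`"; §2 p. 35 "`Δ̄_Θ ≅ (ℤ/lℤ)(1)`"; Def. 2.13 (p. 46)
"the natural isomorphism `μ_N ≅ (l·Δ_Θ) ⊗ (ℤ/Nℤ)`" [cite: MochizukiEtTh2009, Def 2.1 p.35].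

Cell abc-iut, layer L2, item N3 (seat abc-iut-L2-t7): consolidation of inputs. The cocycle data
`XuuCocycleData` (`XuuCocycle.lean`) from which `X̲̲` is constructed carries "`[Δ_Θ : l·Δ_Θ] = l`" and
"`l·Δ_Θ` open in `Δ_Θ`" as fields. Both FOLLOW from seat abc-iut-L2-t8's EXISTING input
`CyclotomeMod 1 l` (`ThetaCyclotomes.lean`: a continuous surjection `red : 1·Δ_Θ ↠ μ_l` with kernel
the `l`-th powers — "`Δ_Θ ≅ Ẑ(1)`" at level `l`, input N2 of t8's report): `1·Δ_Θ = Δ_Θ`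
(`lDeltaTheta_one`), the kernel of `red` read on `Δ_Θ` is `l·Δ_Θ` (`ker_redOne`), so
`[Δ_Θ : l·Δ_Θ] = #μ_l = l` (`index_lDeltaTheta_of_cyclotomeMod`) and `l·Δ_Θ` is open
(`isOpen_lDeltaTheta_of_cyclotomeMod`, `μ_l` discrete). Hence the residual inputs of the `X̲̲`
construction are the extension/normalisation of `η̈^Θ mod l` and N2 only. Nothing here asserts that
such data exist; typed ≠ endorsed; no side is taken on any disputed claim.
-/

noncomputable section

namespace Literature.AnabelianGeometry.EtaleTheta

namespace ThetaSetting

variable {p : ℕ} [Fact p.Prime] (D : ThetaSetting p)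

/-- `1·Δ_Θ = Δ_Θ` (first powers). [cite: MochizukiEtTh2009, §1 p.12] -/
theorem lDeltaTheta_one : D.lDeltaTheta 1 = D.DeltaTheta := by
  ext x
  constructor
  · rintro ⟨y, hy, rfl⟩
    rw [pow_one]; exact hy
  · intro hx
    exact ⟨x, hx, pow_one x⟩

variable {D}

/-- The cyclotome reduction `red : 1·Δ_Θ ↠ μ_l` read on `Δ_Θ` (along `1·Δ_Θ = Δ_Θ`).
[cite: MochizukiEtTh2009, Def 2.13 p.46] -/
def redOne {l : ℕ+} (μ : D.CyclotomeMod 1 l) : D.DeltaTheta →* MuN p l :=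
  μ.red.comp (MulEquiv.subgroupCongr D.lDeltaTheta_one.symm).toMonoidHom

/-- `redOne` evaluated. [cite: MochizukiEtTh2009, Def 2.13 p.46] -/
theorem redOne_apply {l : ℕ+} (μ : D.CyclotomeMod 1 l) (x : D.DeltaTheta) :
    redOne μ x = μ.red ⟨(x : D.GtpTheta), D.lDeltaTheta_one.symm ▸ x.2⟩ :=
  rfl

/-- `redOne` is onto. [cite: MochizukiEtTh2009, Def 2.13 p.46] -/
theorem redOne_surjective {l : ℕ+} (μ : D.CyclotomeMod 1 l) : Function.Surjective (redOne μ) :=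
  μ.red_surjective.comp (MulEquiv.subgroupCongr D.lDeltaTheta_one.symm).surjective

/-- `redOne` is continuous. [cite: MochizukiEtTh2009, Def 2.13 p.46] -/
theorem continuous_redOne {l : ℕ+} (μ : D.CyclotomeMod 1 l) : Continuous (redOne μ) := by
  refine μ.continuous_red.comp ?_
  exact Continuous.subtype_mk continuous_subtype_val _

/-- **`Ker(Δ_Θ ↠ μ_l) = l·Δ_Θ`**: the kernel of the cyclotome reduction on `Δ_Θ` is the subgroup of
`l`-th powers. [cite: MochizukiEtTh2009, Def 2.1 p.35] -/
theorem ker_redOne {l : ℕ+} (μ : D.CyclotomeMod 1 l) :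
    (redOne μ).ker = (D.lDeltaTheta l).subgroupOf D.DeltaTheta := by
  ext x
  rw [MonoidHom.mem_ker, redOne_apply, μ.red_ker, Subgroup.mem_subgroupOf]
  constructor
  · rintro ⟨y, hy⟩
    refine ⟨(y : D.GtpTheta), D.lDeltaTheta_one ▸ y.2, ?_⟩
    have := congrArg (fun z : D.lDeltaTheta 1 => (z : D.GtpTheta)) hy
    simpa using this.symm
  · rintro ⟨y, hy, hyx⟩
    refine ⟨⟨y, D.lDeltaTheta_one.symm ▸ hy⟩, ?_⟩
    apply Subtype.ext
    simp [← hyx]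

/-- **`[Δ_Θ : l·Δ_Θ] = l`** ("`Δ̄_Θ ≅ (ℤ/lℤ)(1)`", p. 35) — from the cyclotome identification
`Δ_Θ/l·Δ_Θ ≅ μ_l` (seat t8's input N2 at level `(1, l)`). [cite: MochizukiEtTh2009, Def 2.1 p.35] -/
theorem index_lDeltaTheta_of_cyclotomeMod {l : ℕ+} (μ : D.CyclotomeMod 1 l) :
    ((D.lDeltaTheta l).subgroupOf D.DeltaTheta).index = l := by
  rw [← ker_redOne μ, Subgroup.index_ker, MonoidHom.range_eq_top.mpr (redOne_surjective μ),
    Subgroup.card_top, Nat.card_eq_fintype_card, card_MuN]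

/-- **`l·Δ_Θ` is open in `Δ_Θ`** (the kernel of a continuous map to the discrete `μ_l`).
[cite: MochizukiEtTh2009, Def 2.1 p.35] -/
theorem isOpen_lDeltaTheta_of_cyclotomeMod {l : ℕ+} (μ : D.CyclotomeMod 1 l) :
    IsOpen (((D.lDeltaTheta l).subgroupOf D.DeltaTheta : Subgroup D.DeltaTheta) :
      Set D.DeltaTheta) := by
  rw [← ker_redOne μ]
  have : (((redOne μ).ker : Subgroup D.DeltaTheta) : Set D.DeltaTheta) = redOne μ ⁻¹' {1} := by
    ext x; simp [MonoidHom.mem_ker]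
  rw [this]
  exact (isOpen_discrete _).preimage (continuous_redOne μ)

end ThetaSetting

end Literature.AnabelianGeometry.EtaleTheta

end
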